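import Summits.ValiantsHypothesis.ValiantsHypothesis.Theorems.BarrierLeverPriorityPeelingLayoutsUpToTwo
import Summits.ValiantsHypothesis.ValiantsHypothesis.Theorems.BarrierLeverPriorityPeelingLayoutSymmetry
import Summits.ValiantsHypothesis.ValiantsHypothesis.Theorems.BarrierLeverPriorityPeelingLayoutsThreeCanon
import Summits.ValiantsHypothesis.ValiantsHypothesis.Theorems.BarrierLeverPriorityPeelingLayoutsThreeCertsA
import Summits.ValiantsHypothesis.ValiantsHypothesis.Theorems.BarrierLeverPriorityPeelingLayoutsThreeCertsB
import Summits.ValiantsHypothesis.ValiantsHypothesis.Theorems.BarrierLeverPriorityPeelingLayoutsThreeCertsC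
import Summits.ValiantsHypothesis.ValiantsHypothesis.Theorems.BarrierLeverPriorityPeelingLayoutsThreeCertsD

/-!
# Route BarrierLever — priority peeling for TT: EVERY layout with `h ≤ 3` is PP-derivable

Helper file (`--supports stmt-ValiantsHypothesis-19761`; cell valiant-natproofs, rung V4, 𝒟-side door
(c); prover val-np-p1 g7; the second rung after `…PriorityPeelingLayoutsUpToTwo`, p474565). Closes NO
item.

* `ppDerivable_h3_of_rep` — transport from an orbit representative: if consistent elements
  `g, g'` of `B₃` (coordinate permutation, flip set, code action; `…LayoutsThreeCanon`) carry the codes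
  of the rows `u i` / columns `w j` into the values of code vectors `v` / `v'`, then a derivation for the
  layout `(T ∘ v, T ∘ v')` gives one for `(u, w)` (`PPSmall.exists_perm_of_forall_exists` +
  `PPSmall.ppDerivable_layout_symm`, p476850, i.e. literal relabeling + slot permutation + re-indexing
  of gen 7's derivations, p475414).
* `ppDerivable_layout_h3` — `h = 3`, every `r`: `r ≤ 2` generic (`…LayoutsSmallRank`), `r ≥ 9`
  impossible, `3 ≤ r ≤ 8` by `canon_h3` (p478031) applied to the image sets of the row codes and of the
  column codes and the 65 machine-emitted orbit-representative certificates
  (`…LayoutsThreeCerts{A,B,C,D}`, p476068 / p476069 / p476071 / p476073).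
* `ppDerivable_layout_of_le_three` — all `h ≤ 3`, all `r`; hence
  `priorityPeelingCertificates_of_le_three` = item 19761's statement (route file, verbatim) with the
  extra hypothesis `h ≤ 3` (via the bridge `PPBridge.closed_of_ppDerivable`, p467389) and
  `transversalMinorLayouts_nonsingular_of_le_three` = item 19152's (TT) conclusion for `h ≤ 3` (via
  `alive_of_ppDerivable`). The `h = 3` census of prover gen 7 (12 021 layouts, kit j256612) is thereby
  a kernel theorem.

WHAT THIS IS NOT: a finite slice (a witness that 19761's clause set is adequate through `h = 3`);
nothing on 19761 / TT for general `h`, on crux stmt-ValiantsHypothesis-14610, or on VP versus VNP.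
-/

-- layout Summits/ValiantsHypothesis/ValiantsHypothesis forces the duplicated namespace component
set_option linter.dupNamespace false

namespace Summit.ValiantsHypothesis.ValiantsHypothesis.Theorems.BarrierLever.PPSmall

open Summit.ValiantsHypothesis.ValiantsHypothesis.Theorems.BarrierLever.PriorityPeeling

/-! ## 1. Transport from an orbit representative -/

/-- From representatives to layouts: consistent group elements `g, g'` carrying the codes of `u`, `w`
into the values of `v`, `v'` transport a derivation for `(T ∘ v, T ∘ v')` to `(u, w)`. -/
theorem ppDerivable_h3_of_rep {r : ℕ} (u w : Fin r → Finset (Fin 3)) (hu : Function.Injective u)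
    (hw : Function.Injective w) (g g' : Equiv.Perm (Fin 3) × Finset (Fin 3) × (Fin 8 → Fin 8))
    (hg : Function.Injective g.2.2 ∧ ∀ (c : Fin 8) (b : Fin 3),
      (b ∈ (![∅, {0}, {1}, {0, 1}, {2}, {0, 2}, {1, 2}, {0, 1, 2}] : Fin 8 → Finset (Fin 3)) c ↔ Xor (g.1 b ∈ (![∅, {0}, {1}, {0, 1}, {2}, {0, 2}, {1, 2}, {0, 1, 2}] : Fin 8 → Finset (Fin 3)) (g.2.2 c)) (g.1 b ∈ g.2.1)))
    (hg' : Function.Injective g'.2.2 ∧ ∀ (c : Fin 8) (b : Fin 3),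
      (b ∈ (![∅, {0}, {1}, {0, 1}, {2}, {0, 2}, {1, 2}, {0, 1, 2}] : Fin 8 → Finset (Fin 3)) c ↔ Xor (g'.1 b ∈ (![∅, {0}, {1}, {0, 1}, {2}, {0, 2}, {1, 2}, {0, 1, 2}] : Fin 8 → Finset (Fin 3)) (g'.2.2 c)) (g'.1 b ∈ g'.2.1)))
    (v v' : Fin r → Fin 8)
    (hv : ∀ i, ∃ j, g.2.2 (if (0 : Fin 3) ∈ u i then
        (if (1 : Fin 3) ∈ u i then (if (2 : Fin 3) ∈ u i then (7 : Fin 8) else 3)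
          else (if (2 : Fin 3) ∈ u i then 5 else 1))
      else
        (if (1 : Fin 3) ∈ u i then (if (2 : Fin 3) ∈ u i then 6 else 2)
          else (if (2 : Fin 3) ∈ u i then 4 else 0))) = v j)
    (hv' : ∀ i, ∃ j, g'.2.2 (if (0 : Fin 3) ∈ w i then
        (if (1 : Fin 3) ∈ w i then (if (2 : Fin 3) ∈ w i then (7 : Fin 8) else 3)
          else (if (2 : Fin 3) ∈ w i then 5 else 1))
      else
        (if (1 : Fin 3) ∈ w i then (if (2 : Fin 3) ∈ w i then 6 else 2)
          else (if (2 : Fin 3) ∈ w i then 4 else 0))) = v' j)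
    (cert : PPDerivable 6 6 (Fin r) 3
      (fun i a => if a ∈ (![∅, {0}, {1}, {0, 1}, {2}, {0, 2}, {1, 2}, {0, 1, 2}] : Fin 8 → Finset (Fin 3)) (v i)
        then Fin.castAdd 3 a else Fin.natAdd 3 a)
      (fun j c => if c ∈ (![∅, {0}, {1}, {0, 1}, {2}, {0, 2}, {1, 2}, {0, 1, 2}] : Fin 8 → Finset (Fin 3)) (v' j)
        then Fin.natAdd 3 c else Fin.castAdd 3 c)) :
    PPDerivable (3 + 3) (3 + 3) (Fin r) 3
      (fun i a => if a ∈ u i then Fin.castAdd 3 a else Fin.natAdd 3 a)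
      (fun j c => if c ∈ w j then Fin.natAdd 3 c else Fin.castAdd 3 c) := by
  have hcu : ∀ i, u i = (![∅, {0}, {1}, {0, 1}, {2}, {0, 2}, {1, 2}, {0, 1, 2}] : Fin 8 → Finset (Fin 3))
      (if (0 : Fin 3) ∈ u i then
        (if (1 : Fin 3) ∈ u i then (if (2 : Fin 3) ∈ u i then (7 : Fin 8) else 3)
          else (if (2 : Fin 3) ∈ u i then 5 else 1))
      else
        (if (1 : Fin 3) ∈ u i then (if (2 : Fin 3) ∈ u i then 6 else 2)
          else (if (2 : Fin 3) ∈ u i then 4 else 0))) := fun i => eq_table_code3 (u i)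
  have hcw : ∀ i, w i = (![∅, {0}, {1}, {0, 1}, {2}, {0, 2}, {1, 2}, {0, 1, 2}] : Fin 8 → Finset (Fin 3))
      (if (0 : Fin 3) ∈ w i then
        (if (1 : Fin 3) ∈ w i then (if (2 : Fin 3) ∈ w i then (7 : Fin 8) else 3)
          else (if (2 : Fin 3) ∈ w i then 5 else 1))
      else
        (if (1 : Fin 3) ∈ w i then (if (2 : Fin 3) ∈ w i then 6 else 2)
          else (if (2 : Fin 3) ∈ w i then 4 else 0))) := fun i => eq_table_code3 (w i)
  have hinj : Function.Injective (fun i => g.2.2 (if (0 : Fin 3) ∈ u i then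
        (if (1 : Fin 3) ∈ u i then (if (2 : Fin 3) ∈ u i then (7 : Fin 8) else 3)
          else (if (2 : Fin 3) ∈ u i then 5 else 1))
      else
        (if (1 : Fin 3) ∈ u i then (if (2 : Fin 3) ∈ u i then 6 else 2)
          else (if (2 : Fin 3) ∈ u i then 4 else 0)))) := by
    intro i j hij
    have h1 := hg.1 hij
    exact hu (by rw [hcu i, hcu j]; exact congrArg _ h1)
  have hinj' : Function.Injective (fun i => g'.2.2 (if (0 : Fin 3) ∈ w i then
        (if (1 : Fin 3) ∈ w i then (if (2 : Fin 3) ∈ w i then (7 : Fin 8) else 3)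
          else (if (2 : Fin 3) ∈ w i then 5 else 1))
      else
        (if (1 : Fin 3) ∈ w i then (if (2 : Fin 3) ∈ w i then 6 else 2)
          else (if (2 : Fin 3) ∈ w i then 4 else 0)))) := by
    intro i j hij
    have h1 := hg'.1 hij
    exact hw (by rw [hcw i, hcw j]; exact congrArg _ h1)
  obtain ⟨σ, hσ⟩ := exists_perm_of_forall_exists hv hinj
  obtain ⟨τ, hτ⟩ := exists_perm_of_forall_exists hv' hinj'
  refine ppDerivable_layout_symm 3 r u w (fun i => (![∅, {0}, {1}, {0, 1}, {2}, {0, 2}, {1, 2}, {0, 1, 2}] : Fin 8 → Finset (Fin 3)) (v i)) (fun j => (![∅, {0}, {1}, {0, 1}, {2}, {0, 2}, {1, 2}, {0, 1, 2}] : Fin 8 → Finset (Fin 3)) (v' j))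
    g.1 g'.1 g.2.1 g'.2.1 σ τ (fun i b => ?_) (fun j b => ?_) cert
  · have h1 := hg.2 (if (0 : Fin 3) ∈ u i then
        (if (1 : Fin 3) ∈ u i then (if (2 : Fin 3) ∈ u i then (7 : Fin 8) else 3)
          else (if (2 : Fin 3) ∈ u i then 5 else 1))
      else
        (if (1 : Fin 3) ∈ u i then (if (2 : Fin 3) ∈ u i then 6 else 2)
          else (if (2 : Fin 3) ∈ u i then 4 else 0))) b
    rw [← hcu i] at h1
    simpa only [hσ i] using h1
  · have h1 := hg'.2 (if (0 : Fin 3) ∈ w j then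
        (if (1 : Fin 3) ∈ w j then (if (2 : Fin 3) ∈ w j then (7 : Fin 8) else 3)
          else (if (2 : Fin 3) ∈ w j then 5 else 1))
      else
        (if (1 : Fin 3) ∈ w j then (if (2 : Fin 3) ∈ w j then 6 else 2)
          else (if (2 : Fin 3) ∈ w j then 4 else 0))) b
    rw [← hcw j] at h1
    simpa only [hτ j] using h1

/-! ## 2. `h = 3`, every `r` -/

/-- **`h = 3`, every `r`.** -/
theorem ppDerivable_layout_h3 (r : ℕ) (u w : Fin r → Finset (Fin 3)) (hu : Function.Injective u)
    (hw : Function.Injective w) :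
    PPDerivable (3 + 3) (3 + 3) (Fin r) 3
      (fun i a => if a ∈ u i then Fin.castAdd 3 a else Fin.natAdd 3 a)
      (fun j c => if c ∈ w j then Fin.natAdd 3 c else Fin.castAdd 3 c) := by
  have hcu : ∀ i, u i = (![∅, {0}, {1}, {0, 1}, {2}, {0, 2}, {1, 2}, {0, 1, 2}] : Fin 8 → Finset (Fin 3))
      (if (0 : Fin 3) ∈ u i then
        (if (1 : Fin 3) ∈ u i then (if (2 : Fin 3) ∈ u i then (7 : Fin 8) else 3)
          else (if (2 : Fin 3) ∈ u i then 5 else 1))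
      else
        (if (1 : Fin 3) ∈ u i then (if (2 : Fin 3) ∈ u i then 6 else 2)
          else (if (2 : Fin 3) ∈ u i then 4 else 0))) := fun i => eq_table_code3 (u i)
  have hcw : ∀ i, w i = (![∅, {0}, {1}, {0, 1}, {2}, {0, 2}, {1, 2}, {0, 1, 2}] : Fin 8 → Finset (Fin 3))
      (if (0 : Fin 3) ∈ w i then
        (if (1 : Fin 3) ∈ w i then (if (2 : Fin 3) ∈ w i then (7 : Fin 8) else 3)
          else (if (2 : Fin 3) ∈ w i then 5 else 1))
      else
        (if (1 : Fin 3) ∈ w i then (if (2 : Fin 3) ∈ w i then 6 else 2)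
          else (if (2 : Fin 3) ∈ w i then 4 else 0))) := fun i => eq_table_code3 (w i)
  set cu : Fin r → Fin 8 := fun i => (if (0 : Fin 3) ∈ u i then
        (if (1 : Fin 3) ∈ u i then (if (2 : Fin 3) ∈ u i then (7 : Fin 8) else 3)
          else (if (2 : Fin 3) ∈ u i then 5 else 1))
      else
        (if (1 : Fin 3) ∈ u i then (if (2 : Fin 3) ∈ u i then 6 else 2)
          else (if (2 : Fin 3) ∈ u i then 4 else 0))) with hcu_def
  set cw : Fin r → Fin 8 := fun i => (if (0 : Fin 3) ∈ w i then
        (if (1 : Fin 3) ∈ w i then (if (2 : Fin 3) ∈ w i then (7 : Fin 8) else 3)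
          else (if (2 : Fin 3) ∈ w i then 5 else 1))
      else
        (if (1 : Fin 3) ∈ w i then (if (2 : Fin 3) ∈ w i then 6 else 2)
          else (if (2 : Fin 3) ∈ w i then 4 else 0))) with hcw_def
  have hinj : Function.Injective cu :=
    fun i j hij => hu (by rw [hcu i, hcu j]; exact congrArg _ hij)
  have hinj' : Function.Injective cw :=
    fun i j hij => hw (by rw [hcw i, hcw j]; exact congrArg _ hij)
  -- the image sets of the codes and their canonical forms
  have hcard : (Finset.univ.image cu).card = r := by
    rw [Finset.card_image_of_injective _ hinj, Finset.card_univ, Fintype.card_fin]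
  have hcard' : (Finset.univ.image cw).card = r := by
    rw [Finset.card_image_of_injective _ hinj', Finset.card_univ, Fintype.card_fin]
  have hmem : ∀ i, cu i ∈ Finset.univ.image cu := fun i => Finset.mem_image_of_mem cu (Finset.mem_univ i)
  have hmem' : ∀ i, cw i ∈ Finset.univ.image cw :=
    fun i => Finset.mem_image_of_mem cw (Finset.mem_univ i)
  obtain ⟨g, -, h3, h4, h5, h6, h7, h8, hg⟩ := canon_h3 (Finset.univ.image cu)
  obtain ⟨g', -, h3', h4', h5', h6', h7', h8', hg'⟩ := canon_h3 (Finset.univ.image cw)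
  rcases r with _ | _ | _ | _ | _ | _ | _ | _ | _ | r
  · exact ppDerivable_layout_r0 3 u w
  · exact ppDerivable_layout_r1 3 u w
  · exact ppDerivable_layout_r2 3 u w hu hw
  · -- r = 3
    rcases h3 hcard with hd | hd | hd <;> rcases h3' hcard' with hd' | hd' | hd' <;>
      (have hv := fun i => hd (cu i) (hmem i)) <;>
      (have hv' := fun i => hd' (cw i) (hmem' i))
    · exact ppDerivable_h3_of_rep u w hu hw g g' hg hg' _ _ hv hv' cert_h3_r3_012_012
    · exact ppDerivable_h3_of_rep u w hu hw g g' hg hg' _ _ hv hv' cert_h3_r3_012_016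
    · exact ppDerivable_h3_of_rep u w hu hw g g' hg hg' _ _ hv hv' cert_h3_r3_012_035
    · exact ppDerivable_h3_of_rep u w hu hw g g' hg hg' _ _ hv hv' cert_h3_r3_016_012
    · exact ppDerivable_h3_of_rep u w hu hw g g' hg hg' _ _ hv hv' cert_h3_r3_016_016
    · exact ppDerivable_h3_of_rep u w hu hw g g' hg hg' _ _ hv hv' cert_h3_r3_016_035
    · exact ppDerivable_h3_of_rep u w hu hw g g' hg hg' _ _ hv hv' cert_h3_r3_035_012
    · exact ppDerivable_h3_of_rep u w hu hw g g' hg hg' _ _ hv hv' cert_h3_r3_035_016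
    · exact ppDerivable_h3_of_rep u w hu hw g g' hg hg' _ _ hv hv' cert_h3_r3_035_035
  · -- r = 4
    rcases h4 hcard with hd | hd | hd | hd | hd | hd <;> rcases h4' hcard' with hd' | hd' | hd' | hd' | hd' | hd' <;>
      (have hv := fun i => hd (cu i) (hmem i)) <;>
      (have hv' := fun i => hd' (cw i) (hmem' i))
    · exact ppDerivable_h3_of_rep u w hu hw g g' hg hg' _ _ hv hv' cert_h3_r4_0123_0123
    · exact ppDerivable_h3_of_rep u w hu hw g g' hg hg' _ _ hv hv' cert_h3_r4_0123_0124
    · exact ppDerivable_h3_of_rep u w hu hw g g' hg hg' _ _ hv hv' cert_h3_r4_0123_0125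
    · exact ppDerivable_h3_of_rep u w hu hw g g' hg hg' _ _ hv hv' cert_h3_r4_0123_0127
    · exact ppDerivable_h3_of_rep u w hu hw g g' hg hg' _ _ hv hv' cert_h3_r4_0123_0167
    · exact ppDerivable_h3_of_rep u w hu hw g g' hg hg' _ _ hv hv' cert_h3_r4_0123_0356
    · exact ppDerivable_h3_of_rep u w hu hw g g' hg hg' _ _ hv hv' cert_h3_r4_0124_0123
    · exact ppDerivable_h3_of_rep u w hu hw g g' hg hg' _ _ hv hv' cert_h3_r4_0124_0124
    · exact ppDerivable_h3_of_rep u w hu hw g g' hg hg' _ _ hv hv' cert_h3_r4_0124_0125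
    · exact ppDerivable_h3_of_rep u w hu hw g g' hg hg' _ _ hv hv' cert_h3_r4_0124_0127
    · exact ppDerivable_h3_of_rep u w hu hw g g' hg hg' _ _ hv hv' cert_h3_r4_0124_0167
    · exact ppDerivable_h3_of_rep u w hu hw g g' hg hg' _ _ hv hv' cert_h3_r4_0124_0356
    · exact ppDerivable_h3_of_rep u w hu hw g g' hg hg' _ _ hv hv' cert_h3_r4_0125_0123
    · exact ppDerivable_h3_of_rep u w hu hw g g' hg hg' _ _ hv hv' cert_h3_r4_0125_0124
    · exact ppDerivable_h3_of_rep u w hu hw g g' hg hg' _ _ hv hv' cert_h3_r4_0125_0125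
    · exact ppDerivable_h3_of_rep u w hu hw g g' hg hg' _ _ hv hv' cert_h3_r4_0125_0127
    · exact ppDerivable_h3_of_rep u w hu hw g g' hg hg' _ _ hv hv' cert_h3_r4_0125_0167
    · exact ppDerivable_h3_of_rep u w hu hw g g' hg hg' _ _ hv hv' cert_h3_r4_0125_0356
    · exact ppDerivable_h3_of_rep u w hu hw g g' hg hg' _ _ hv hv' cert_h3_r4_0127_0123
    · exact ppDerivable_h3_of_rep u w hu hw g g' hg hg' _ _ hv hv' cert_h3_r4_0127_0124
    · exact ppDerivable_h3_of_rep u w hu hw g g' hg hg' _ _ hv hv' cert_h3_r4_0127_0125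
    · exact ppDerivable_h3_of_rep u w hu hw g g' hg hg' _ _ hv hv' cert_h3_r4_0127_0127
    · exact ppDerivable_h3_of_rep u w hu hw g g' hg hg' _ _ hv hv' cert_h3_r4_0127_0167
    · exact ppDerivable_h3_of_rep u w hu hw g g' hg hg' _ _ hv hv' cert_h3_r4_0127_0356
    · exact ppDerivable_h3_of_rep u w hu hw g g' hg hg' _ _ hv hv' cert_h3_r4_0167_0123
    · exact ppDerivable_h3_of_rep u w hu hw g g' hg hg' _ _ hv hv' cert_h3_r4_0167_0124
    · exact ppDerivable_h3_of_rep u w hu hw g g' hg hg' _ _ hv hv' cert_h3_r4_0167_0125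
    · exact ppDerivable_h3_of_rep u w hu hw g g' hg hg' _ _ hv hv' cert_h3_r4_0167_0127
    · exact ppDerivable_h3_of_rep u w hu hw g g' hg hg' _ _ hv hv' cert_h3_r4_0167_0167
    · exact ppDerivable_h3_of_rep u w hu hw g g' hg hg' _ _ hv hv' cert_h3_r4_0167_0356
    · exact ppDerivable_h3_of_rep u w hu hw g g' hg hg' _ _ hv hv' cert_h3_r4_0356_0123
    · exact ppDerivable_h3_of_rep u w hu hw g g' hg hg' _ _ hv hv' cert_h3_r4_0356_0124
    · exact ppDerivable_h3_of_rep u w hu hw g g' hg hg' _ _ hv hv' cert_h3_r4_0356_0125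
    · exact ppDerivable_h3_of_rep u w hu hw g g' hg hg' _ _ hv hv' cert_h3_r4_0356_0127
    · exact ppDerivable_h3_of_rep u w hu hw g g' hg hg' _ _ hv hv' cert_h3_r4_0356_0167
    · exact ppDerivable_h3_of_rep u w hu hw g g' hg hg' _ _ hv hv' cert_h3_r4_0356_0356
  · -- r = 5
    rcases h5 hcard with hd | hd | hd <;> rcases h5' hcard' with hd' | hd' | hd' <;>
      (have hv := fun i => hd (cu i) (hmem i)) <;>
      (have hv' := fun i => hd' (cw i) (hmem' i))
    · exact ppDerivable_h3_of_rep u w hu hw g g' hg hg' _ _ hv hv' cert_h3_r5_01234_01234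
    · exact ppDerivable_h3_of_rep u w hu hw g g' hg hg' _ _ hv hv' cert_h3_r5_01234_01247
    · exact ppDerivable_h3_of_rep u w hu hw g g' hg hg' _ _ hv hv' cert_h3_r5_01234_01256
    · exact ppDerivable_h3_of_rep u w hu hw g g' hg hg' _ _ hv hv' cert_h3_r5_01247_01234
    · exact ppDerivable_h3_of_rep u w hu hw g g' hg hg' _ _ hv hv' cert_h3_r5_01247_01247
    · exact ppDerivable_h3_of_rep u w hu hw g g' hg hg' _ _ hv hv' cert_h3_r5_01247_01256
    · exact ppDerivable_h3_of_rep u w hu hw g g' hg hg' _ _ hv hv' cert_h3_r5_01256_01234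
    · exact ppDerivable_h3_of_rep u w hu hw g g' hg hg' _ _ hv hv' cert_h3_r5_01256_01247
    · exact ppDerivable_h3_of_rep u w hu hw g g' hg hg' _ _ hv hv' cert_h3_r5_01256_01256
  · -- r = 6
    rcases h6 hcard with hd | hd | hd <;> rcases h6' hcard' with hd' | hd' | hd' <;>
      (have hv := fun i => hd (cu i) (hmem i)) <;>
      (have hv' := fun i => hd' (cw i) (hmem' i))
    · exact ppDerivable_h3_of_rep u w hu hw g g' hg hg' _ _ hv hv' cert_h3_r6_012345_012345
    · exact ppDerivable_h3_of_rep u w hu hw g g' hg hg' _ _ hv hv' cert_h3_r6_012345_012347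
    · exact ppDerivable_h3_of_rep u w hu hw g g' hg hg' _ _ hv hv' cert_h3_r6_012345_012567
    · exact ppDerivable_h3_of_rep u w hu hw g g' hg hg' _ _ hv hv' cert_h3_r6_012347_012345
    · exact ppDerivable_h3_of_rep u w hu hw g g' hg hg' _ _ hv hv' cert_h3_r6_012347_012347
    · exact ppDerivable_h3_of_rep u w hu hw g g' hg hg' _ _ hv hv' cert_h3_r6_012347_012567
    · exact ppDerivable_h3_of_rep u w hu hw g g' hg hg' _ _ hv hv' cert_h3_r6_012567_012345
    · exact ppDerivable_h3_of_rep u w hu hw g g' hg hg' _ _ hv hv' cert_h3_r6_012567_012347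
    · exact ppDerivable_h3_of_rep u w hu hw g g' hg hg' _ _ hv hv' cert_h3_r6_012567_012567
  · -- r = 7
    have hd := h7 hcard
    have hd' := h7' hcard'
    have hv := fun i => hd (cu i) (hmem i)
    have hv' := fun i => hd' (cw i) (hmem' i)
    exact ppDerivable_h3_of_rep u w hu hw g g' hg hg' _ _ hv hv' cert_h3_r7_0123456_0123456
  · -- r = 8
    have hd := h8 hcard
    have hd' := h8' hcard'
    have hv := fun i => hd (cu i) (hmem i)
    have hv' := fun i => hd' (cw i) (hmem' i)
    exact ppDerivable_h3_of_rep u w hu hw g g' hg hg' _ _ hv hv' cert_h3_r8_01234567_01234567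
  · -- r ≥ 9 : impossible
    exfalso
    have h1 := Fintype.card_le_of_injective cu hinj
    simp only [Fintype.card_fin] at h1
    omega

/-! ## 3. All layouts with `h ≤ 3`; the slices of items 19761 and 19152 -/

/-- **Every injective TT layout with `h ≤ 3` has a priority-peeling derivation.** -/
theorem ppDerivable_layout_of_le_three (h r : ℕ) (hh : h ≤ 3) (u w : Fin r → Finset (Fin h))
    (hu : Function.Injective u) (hw : Function.Injective w) :
    PPDerivable (h + h) (h + h) (Fin r) h
      (fun i a => if a ∈ u i then Fin.castAdd h a else Fin.natAdd h a)
      (fun j c => if c ∈ w j then Fin.natAdd h c else Fin.castAdd h c) := by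
  interval_cases h
  · exact ppDerivable_layout_h0 r u w hu
  · exact ppDerivable_layout_h1 r u w hu hw
  · exact ppDerivable_layout_h2 r u w hu hw
  · exact ppDerivable_layout_h3 r u w hu hw

/-- **The `h ≤ 3` slice of TT** (item 19152 `TransversalMinorLayoutsNonsingular`, its conclusion
verbatim): every injective layout with `h ≤ 3` has a nonsingular layout matrix for some `H`. -/
theorem transversalMinorLayouts_nonsingular_of_le_three (h r : ℕ) (hh : h ≤ 3)
    (u w : Fin r → Finset (Fin h)) (hu : Function.Injective u) (hw : Function.Injective w) :
    ∃ H : Matrix (Fin (h + h)) (Fin (h + h)) ℂ, (Matrix.of fun i j : Fin r =>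
      (H.submatrix (fun a : Fin h => if a ∈ u i then Fin.castAdd h a else Fin.natAdd h a)
        (fun c : Fin h => if c ∈ w j then Fin.natAdd h c else Fin.castAdd h c)).det).det ≠ 0 :=
  alive_of_ppDerivable (ppDerivable_layout_of_le_three h r hh u w hu hw)

/-- **The `h ≤ 3` slice of item 19761 `PriorityPeelingCertificatesExist`**: the item's statement
(route file, verbatim) with the extra hypothesis `h ≤ 3` — every predicate on configurations closed
under clauses (0)–(4) contains every injective TT layout with `h ≤ 3`. Via the bridge
`PPBridge.closed_of_ppDerivable`. -/
theorem priorityPeelingCertificates_of_le_three :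
    ∀ P : (nr nc r d : ℕ) → (Fin r → Fin d → Fin nr) → (Fin r → Fin d → Fin nc) → Prop,
    (∀ (nr nc r d : ℕ) (ρ : Fin r → Fin d → Fin nr) (κ : Fin r → Fin d → Fin nc)
      (σ τ : Equiv.Perm (Fin r)) (α β : Fin r → Equiv.Perm (Fin d)),
      P nr nc r d (fun i a => ρ (σ i) (α i a)) (fun j c => κ (τ j) (β j c)) → P nr nc r d ρ κ) →
    (∀ (nr nc r d : ℕ) (ρ : Fin r → Fin d → Fin nr) (κ : Fin r → Fin d → Fin nc),
      P nc nr r d κ ρ → P nr nc r d ρ κ) →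
    (∀ (nr nc d : ℕ) (ρ : Fin 0 → Fin d → Fin nr) (κ : Fin 0 → Fin d → Fin nc), P nr nc 0 d ρ κ) →
    (∀ (nr nc d : ℕ) (ρ : Fin 1 → Fin d → Fin nr) (κ : Fin 1 → Fin d → Fin nc),
      Function.Injective (ρ 0) → Function.Injective (κ 0) → P nr nc 1 d ρ κ) →
    (∀ (nr nc r : ℕ) (ρ : Fin r → Fin 1 → Fin nr) (κ : Fin r → Fin 1 → Fin nc),
      Function.Injective (fun i => ρ i 0) → Function.Injective (fun j => κ j 0) → P nr nc r 1 ρ κ) →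
    (∀ (nr nc d : ℕ) (ρ : Fin 2 → Fin d → Fin nr) (κ : Fin 2 → Fin d → Fin nc),
      Function.Injective (ρ 0) → Function.Injective (ρ 1) → Function.Injective (κ 0) →
      Function.Injective (κ 1) → Set.range (ρ 0) ≠ Set.range (ρ 1) →
      Set.range (κ 0) ≠ Set.range (κ 1) → P nr nc 2 d ρ κ) →
    (∀ (nr nc k m d : ℕ) (ρ : Fin (k + m) → Fin (d + 1) → Fin nr)
      (κ : Fin (k + m) → Fin (d + 1) → Fin nc) (ℓ₀ ℓ₁ : Fin nr) (prio : Fin nc → ℕ)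
      (T : Finset (Fin nc)), ℓ₀ ≠ ℓ₁ → (∀ i : Fin k, ρ (Fin.castAdd m i) 0 = ℓ₀) →
      (∀ i : Fin m, ρ (Fin.natAdd k i) 0 = ℓ₁) →
      (∀ (i : Fin (k + m)) (a : Fin d), ρ i a.succ ≠ ℓ₀ ∧ ρ i a.succ ≠ ℓ₁) →
      (∀ (j : Fin (k + m)) (c : Fin d), prio (κ j c.succ) < prio (κ j 0)) →
      (∀ j : Fin k, κ (Fin.castAdd m j) 0 ∈ T) → (∀ j : Fin m, κ (Fin.natAdd k j) 0 ∉ T) →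
      P nr nc k d (fun i a => ρ (Fin.castAdd m i) a.succ) (fun j c => κ (Fin.castAdd m j) c.succ) →
      P nr nc m d (fun i a => ρ (Fin.natAdd k i) a.succ) (fun j c => κ (Fin.natAdd k j) c.succ) →
      P nr nc (k + m) (d + 1) ρ κ) →
    (∀ (nr nc r d : ℕ) (ρ : Fin r → Fin d → Fin nr) (κ : Fin r → Fin d → Fin nc) (x y : Fin nc),
      x ≠ y → P nr nc r d ρ (fun j c => if κ j c = x ∧ (∀ c' : Fin d, κ j c' ≠ y) then y else κ j c) →
      P nr nc r d ρ κ) →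
    ∀ (h r : ℕ) (u w : Fin r → Finset (Fin h)), h ≤ 3 → Function.Injective u →
      Function.Injective w →
      P (h + h) (h + h) r h (fun i a => if a ∈ u i then Fin.castAdd h a else Fin.natAdd h a)
        (fun j c => if c ∈ w j then Fin.natAdd h c else Fin.castAdd h c) := by
  intro Q h0 h1 h2a h2b h2c _h2d h3 h4 h r u w hh hu hw
  exact PPBridge.closed_of_ppDerivable Q h0 h1 h2a h2b h2c h3 h4
    (ppDerivable_layout_of_le_three h r hh u w hu hw) r (Equiv.refl _)

end Summit.ValiantsHypothesis.ValiantsHypothesis.Theorems.BarrierLever.PPSmall
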